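import Mathlib
import HarnessLib
import Summits.AtomisticToContinuum.Crystallization.Theorems.PricedLinkCensusSoftFourRingsVertexFan

/-!
# Soft four-rings: path enumeration of a three-fan link

Support file for `SoftFourRings` (route `PricedLinkCensus`, sub-problem `Crystallization`).
Bond-pair bookkeeping (`close_of_mem_bonds`, `ne_of_mem_bonds`) and
`exists_path_family_of_three`: if `t_v = 3`, the four bonds of `v` can be re-indexed
`w 0 – w 1 – w 2 – w 3` with the bonds among them exactly the path.
-/

namespace Summit.AtomisticToContinuum.Crystallization.Theorems

open Real RealInnerProductSpace Literature.Geometry.DiscreteGeometry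

section Bonds

variable {X : Finset (EuclideanSpace ℝ (Fin 3))} {B : Finset (Finset (EuclideanSpace ℝ (Fin 3)))}

/-- A bond pair is close (degenerate pairs included, for unit vectors). -/
theorem close_of_mem_bonds (hX1 : ∀ y ∈ X, ‖y‖ = 1)
    (hB : ∀ T ∈ B, ∃ u ∈ X, ∃ u' ∈ X, u ≠ u' ∧ 1 - (101 / 100 : ℝ) ^ 2 / 2 ≤ ⟪u, u'⟫ ∧ T = {u, u'})
    (y y' : EuclideanSpace ℝ (Fin 3)) (h : ({y, y'} : Finset (EuclideanSpace ℝ (Fin 3))) ∈ B) :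
    1 - (101 / 100 : ℝ) ^ 2 / 2 ≤ ⟪y, y'⟫ := by
  by_cases hyy : y = y'
  · subst hyy
    obtain ⟨u, hu, u', hu', -, -, hT'⟩ := hB _ h
    have hy : y ∈ X := by
      have : y ∈ ({u, u'} : Finset (EuclideanSpace ℝ (Fin 3))) := by
        rw [← hT']; exact Finset.mem_insert_self _ _
      rw [Finset.mem_insert, Finset.mem_singleton] at this
      rcases this with rfl | rfl
      exacts [hu, hu']
    rw [real_inner_self_eq_norm_sq, hX1 y hy]; norm_num
  · exact (close_of_pair_mem_bonds hB h hyy).2.2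

/-- The two points of a bond pair are distinct. -/
theorem ne_of_mem_bonds
    (hB : ∀ T ∈ B, ∃ u ∈ X, ∃ u' ∈ X, u ≠ u' ∧ 1 - (101 / 100 : ℝ) ^ 2 / 2 ≤ ⟪u, u'⟫ ∧ T = {u, u'})
    {a b : EuclideanSpace ℝ (Fin 3)} (h : ({a, b} : Finset (EuclideanSpace ℝ (Fin 3))) ∈ B) :
    a ≠ b := by
  rintro rfl
  obtain ⟨u, -, u', -, huu', -, hT'⟩ := hB _ h
  have h2 : ({u, u'} : Finset (EuclideanSpace ℝ (Fin 3))).card = 2 := Finset.card_pair huu'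
  rw [← hT'] at h2
  simp at h2

variable (hX1 : ∀ y ∈ X, ‖y‖ = 1)
  (h0 : (0 : EuclideanSpace ℝ (Fin 3)) ∈
    interior (convexHull ℝ (X : Set (EuclideanSpace ℝ (Fin 3)))))
  (hsepX : ∀ u ∈ X, ∀ u' ∈ X, u ≠ u' → ⟪u, u'⟫ ≤ 1 - 1 / (2 * (101 / 100 : ℝ) ^ 2))
  (hB : ∀ T ∈ B, ∃ u ∈ X, ∃ u' ∈ X, u ≠ u' ∧ 1 - (101 / 100 : ℝ) ^ 2 / 2 ≤ ⟪u, u'⟫ ∧ T = {u, u'})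
  {v : EuclideanSpace ℝ (Fin 3)} (hv : v ∈ X) (w : Fin 4 → EuclideanSpace ℝ (Fin 3))
  (hwX : ∀ k, w k ∈ X) (hwinj : Function.Injective w) (hwv : ∀ k, w k ≠ v)
  (hvw : ∀ k, ({v, w k} : Finset (EuclideanSpace ℝ (Fin 3))) ∈ B)
  (hvonly : ∀ y, ({v, y} : Finset (EuclideanSpace ℝ (Fin 3))) ∈ B → ∃ k, y = w k)

/-- Every index of `Fin 4` is one of four distinct ones. -/
theorem fin_four_eq_of_nodup : ∀ i j k l : Fin 4, [i, j, k, l].Nodup →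
    ∀ m : Fin 4, m = i ∨ m = j ∨ m = k ∨ m = l := by
  decide

include hX1 h0 hsepX hB hv hwX hwinj hwv hvw hvonly in
open scoped Classical in
/-- **Path re-indexing of the link of a three-fan vertex.**  If `t_v = 3`, the four bonds of `v`
can be enumerated `w' 0, …, w' 3` so that the bonds among them are exactly
`{w' 0, w' 1}, {w' 1, w' 2}, {w' 2, w' 3}`. -/
theorem exists_path_family_of_three
    (h3 : ((facetNormals X).filter (fun c => v ∈ tightSet X c ∧ (tightSet X c).card = 3 ∧
      ((edgesOfFacet X c).filter (fun T => T ∉ B)).card = 0)).card = 3) :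
    ∃ w' : Fin 4 → EuclideanSpace ℝ (Fin 3), (∀ k, w' k ∈ X) ∧ Function.Injective w' ∧
      (∀ k, w' k ≠ v) ∧ (∀ k, ({v, w' k} : Finset (EuclideanSpace ℝ (Fin 3))) ∈ B) ∧
      (∀ y, ({v, y} : Finset (EuclideanSpace ℝ (Fin 3))) ∈ B → ∃ k, y = w' k) ∧
      ({w' 0, w' 1} : Finset (EuclideanSpace ℝ (Fin 3))) ∈ B ∧
      ({w' 1, w' 2} : Finset (EuclideanSpace ℝ (Fin 3))) ∈ B ∧
      ({w' 2, w' 3} : Finset (EuclideanSpace ℝ (Fin 3))) ∈ B ∧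
      ({w' 0, w' 2} : Finset (EuclideanSpace ℝ (Fin 3))) ∉ B ∧
      ({w' 1, w' 3} : Finset (EuclideanSpace ℝ (Fin 3))) ∉ B ∧
      ({w' 0, w' 3} : Finset (EuclideanSpace ℝ (Fin 3))) ∉ B := by
  obtain ⟨i, j, k, l, hij, hik, hil, hjk, hjl, hkl, hBij, hBjk, hBkl, hBik, hBjl, hBil⟩ :=
    exists_fan_of_three_bondTriangles_at hX1 h0 hsepX hB hv w hwX hwinj hwv hvw hvonly h3
  have hnd : [i, j, k, l].Nodup := by simp [hij, hik, hil, hjk, hjl, hkl]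
  refine ⟨![w i, w j, w k, w l], ?_, ?_, ?_, ?_, ?_, ?_⟩
  · intro m; fin_cases m <;> simp [hwX]
  · intro m n h
    fin_cases m <;> fin_cases n
    all_goals first
      | rfl
      | (simp only [Fin.zero_eta, Fin.mk_one, Fin.reduceFinMk, Matrix.cons_val_zero,
          Matrix.cons_val_one, Matrix.cons_val] at h
         first
          | exact absurd (hwinj h) hij | exact absurd (hwinj h).symm hij
          | exact absurd (hwinj h) hik | exact absurd (hwinj h).symm hik
          | exact absurd (hwinj h) hil | exact absurd (hwinj h).symm hil
          | exact absurd (hwinj h) hjk | exact absurd (hwinj h).symm hjk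
          | exact absurd (hwinj h) hjl | exact absurd (hwinj h).symm hjl
          | exact absurd (hwinj h) hkl | exact absurd (hwinj h).symm hkl)
  · intro m; fin_cases m <;> simp [hwv]
  · intro m; fin_cases m <;> simp [hvw]
  · intro y hy
    obtain ⟨m, rfl⟩ := hvonly y hy
    rcases fin_four_eq_of_nodup i j k l hnd m with rfl | rfl | rfl | rfl
    exacts [⟨0, by simp⟩, ⟨1, by simp⟩, ⟨2, by simp⟩, ⟨3, by simp⟩]
  · simp only [Fin.isValue, Matrix.cons_val_zero, Matrix.cons_val_one, Matrix.cons_val]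
    exact ⟨hBij, hBjk, hBkl, hBik, hBjl, hBil⟩

end Bonds

end Summit.AtomisticToContinuum.Crystallization.Theorems
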